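import Literature.NumberTheory.LFunctions.SchoenfeldZeroSums
import Mathlib.NumberTheory.Harmonic.ZetaAsymp
import HarnessLib

/-!
# HANDOFF — the two-sided Weil zero sum of a REAL test function is twice the one-sided sum over `zerosBetween 0 T` (rh-explicit, track «HANDOFF», seat prove-2 gen9; glue for `DodgerZeroSumClaim`, ATTEMPT-18 §2)

HONEST FRAMING. Nothing here bears on the truth of RH; this is bookkeeping. The typed target of the dodger programme
(`HandoffDodgerZeroSumReduction.SubwindowZeroSumFamily`, prove-2 gen8) asks for a bound, uniform in `T`, of the TWO-SIDED truncated
zero sum `∑ᶠ ρ ∈ weilZeroIndex T, m(ρ)·‖Ĝ(ρ)‖²` (both signs of `Im ρ`), which is the shape the zero-side domination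
`re_weilQuadratic_le_of_zeroSum_le` consumes; the COST bricks (`HandoffDodgerFarZone`, `HandoffDodgerFarCost`,
`HandoffDodgerWitnessTransform`) are stated over finite sets of zeros in the UPPER strip. THIS FILE is the bridge:

* `weilZeroIndex_toFinset_eq` — as a finite set of complex numbers, `weilZeroIndex T = zerosBetween 0 T ∪ conj(zerosBetween 0 T)`,
  disjointly (`disjoint_zerosBetween_image_conj`);
* `finsum_weilZeroIndex_eq_two_mul_sum` — for a conjugation-invariant weight `g`,
  `∑ᶠ ρ ∈ weilZeroIndex T, g ρ = 2·Σ_{ρ ∈ zerosBetween 0 T} g ρ` (every real `T`);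
* `norm_weilMellin_conj_of_real` — `‖ĝ(ρ̄)‖ = ‖ĝ(ρ)‖` for real-valued `g`;
* **`finsum_weilZeroIndex_normSq_eq_two_mul`** — for a real-valued `g`:
  `∑ᶠ ρ ∈ weilZeroIndex T, m(ρ)‖ĝ(ρ)‖² = 2·Σ_{ρ ∈ zerosBetween 0 T} m(ρ)‖ĝ(ρ)‖²` (every real `T`);
* `zeroSum_le_of_upper_le` — hence a bound `Σ_{ρ ∈ zerosBetween 0 T} m(ρ)‖ĝ(ρ)‖² ≤ B/2` for all `T ≥ 0` gives the hypothesis of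
  `re_weilQuadratic_le_of_zeroSum_le` with constant `B`.
No `sorry`, standard axioms, no definitions.

References: this track (ATTEMPT-18 §2). E. C. Titchmarsh, The Theory of the Riemann Zeta-Function, 2nd ed. (1986), §2.12
(`m(ρ̄) = m(ρ)`; tree `riemannZetaZeroOrder_conj_holds`).
-/

set_option linter.dupNamespace false

noncomputable section

open Real Finset Complex
open scoped ComplexConjugate

namespace Summit.RiemannHypothesis.RiemannHypothesis.Theorems.Handoff

open Literature.NumberTheory.LFunctions Literature.NumberTheory.LFunctions.SchoenfeldBound

/-- The truncated Weil zero index, as a finite set of complex numbers, is the upper box `zerosBetween 0 T` together with its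
(disjoint) mirror image under conjugation. [folklore] -/
theorem weilZeroIndex_toFinset_eq (T : ℝ) :
    (weilZeroIndex_finite T).toFinset = zerosBetween 0 T ∪ (zerosBetween 0 T).image conj := by
  ext ρ
  simp only [Set.Finite.mem_toFinset, weilZeroIndex, Set.mem_setOf_eq, Finset.mem_union, Finset.mem_image,
    mem_zerosBetween le_rfl]
  constructor
  · rintro ⟨hz, h1, h2, h3, h4⟩
    rcases lt_or_gt_of_ne h3 with h | h
    · refine Or.inr ⟨conj ρ, ⟨?_, ?_, ?_, ?_, ?_⟩, Complex.conj_conj ρ⟩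
      · rw [riemannZeta_conj, hz, map_zero]
      · simpa using h1
      · simpa using h2
      · simp only [Complex.conj_im]; linarith
      · simp only [Complex.conj_im]; rw [abs_of_neg h] at h4; exact h4
    · exact Or.inl ⟨hz, h1, h2, h, by rw [abs_of_pos h] at h4; exact h4⟩
  · rintro (⟨hz, h1, h2, h3, h4⟩ | ⟨ρ', ⟨hz, h1, h2, h3, h4⟩, rfl⟩)
    · exact ⟨hz, h1, h2, h3.ne', by rw [abs_of_pos h3]; exact h4⟩
    · refine ⟨?_, ?_, ?_, ?_, ?_⟩
      · rw [riemannZeta_conj, hz, map_zero]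
      · simpa using h1
      · simpa using h2
      · simp only [Complex.conj_im]; linarith
      · simp only [Complex.conj_im, abs_neg]; rw [abs_of_pos h3]; exact h4

/-- The box and its mirror image are disjoint (upper vs lower half-plane). [folklore] -/
theorem disjoint_zerosBetween_image_conj (T : ℝ) :
    Disjoint (zerosBetween 0 T) ((zerosBetween 0 T).image conj) := by
  rw [Finset.disjoint_left]
  intro ρ hρ hρ'
  obtain ⟨ρ', hρ'', rfl⟩ := Finset.mem_image.1 hρ'
  have h1 := ((mem_zerosBetween le_rfl).1 hρ).2.2.2.1
  have h2 := ((mem_zerosBetween le_rfl).1 hρ'').2.2.2.1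
  simp only [Complex.conj_im] at h1
  linarith

/-- For a conjugation-invariant weight, the two-sided truncated zero sum is twice the one-sided one:
`∑ᶠ ρ ∈ weilZeroIndex T, g ρ = 2·Σ_{ρ ∈ zerosBetween 0 T} g ρ` (every real `T`; both sides vanish for `T < 0`).
[cite: Titchmarsh1986, §2.12] -/
theorem finsum_weilZeroIndex_eq_two_mul_sum {g : ℂ → ℝ} (hg : ∀ z : ℂ, g (conj z) = g z) (T : ℝ) :
    ∑ᶠ ρ ∈ weilZeroIndex T, g ρ = 2 * ∑ ρ ∈ zerosBetween 0 T, g ρ := by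
  rw [finsum_mem_eq_finite_toFinset_sum g (weilZeroIndex_finite T), weilZeroIndex_toFinset_eq,
    Finset.sum_union (disjoint_zerosBetween_image_conj T),
    Finset.sum_image fun x _ y _ h => (starRingEnd ℂ).injective h]
  simp only [hg]
  ring

/-- For a REAL-valued `g`, `‖ĝ(s̄)‖ = ‖ĝ(s)‖` (`ĝ(s̄) = conj ĝ(s)`: conjugation commutes with the integral). [folklore] -/
theorem norm_weilMellin_conj_of_real {g : ℝ → ℂ} (hreal : ∀ t : ℝ, (g t).im = 0) (s : ℂ) :
    ‖weilMellin g (conj s)‖ = ‖weilMellin g s‖ := by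
  have h : weilMellin g (conj s) = conj (weilMellin g s) := by
    rw [weilMellin, weilMellin, ← integral_conj]
    refine MeasureTheory.integral_congr_ae (Filter.Eventually.of_forall fun t => ?_)
    simp only [map_mul, ← Complex.exp_conj, map_sub, map_div₀, map_one, map_ofNat, Complex.conj_ofReal,
      Complex.conj_eq_iff_im.2 (hreal t)]
  rw [h, Complex.norm_conj]

/-- **The two-sided Weil zero sum of a real test function.** For real-valued `g` and every real `T`:
`∑ᶠ ρ ∈ weilZeroIndex T, m(ρ)‖ĝ(ρ)‖² = 2·Σ_{ρ ∈ zerosBetween 0 T} m(ρ)‖ĝ(ρ)‖²`. [this track, ATTEMPT-18 §2] -/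
theorem finsum_weilZeroIndex_normSq_eq_two_mul {g : ℝ → ℂ} (hreal : ∀ t : ℝ, (g t).im = 0) (T : ℝ) :
    ∑ᶠ ρ ∈ weilZeroIndex T, (riemannZetaZeroOrder ρ : ℝ) * ‖weilMellin g ρ‖ ^ 2 =
      2 * ∑ ρ ∈ zerosBetween 0 T, (riemannZetaZeroOrder ρ : ℝ) * ‖weilMellin g ρ‖ ^ 2 := by
  refine finsum_weilZeroIndex_eq_two_mul_sum (fun z => ?_) T
  rw [riemannZetaZeroOrder_conj_holds z, norm_weilMellin_conj_of_real hreal z]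

/-- **From one-sided to two-sided bounds.** If `Σ_{ρ ∈ zerosBetween 0 T} m(ρ)‖ĝ(ρ)‖² ≤ B/2` for every `T ≥ 0` (real-valued `g`,
`B ≥ 0`), then `∑ᶠ ρ ∈ weilZeroIndex T, m(ρ)‖ĝ(ρ)‖² ≤ B` for EVERY real `T` — the hypothesis of the tree's zero-side domination
`re_weilQuadratic_le_of_zeroSum_le`. [this track, ATTEMPT-18 §2] -/
theorem zeroSum_le_of_upper_le {g : ℝ → ℂ} (hreal : ∀ t : ℝ, (g t).im = 0) {B : ℝ} (hB : 0 ≤ B)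
    (h : ∀ T : ℝ, 0 ≤ T → ∑ ρ ∈ zerosBetween 0 T, (riemannZetaZeroOrder ρ : ℝ) * ‖weilMellin g ρ‖ ^ 2 ≤ B / 2) (T : ℝ) :
    ∑ᶠ ρ ∈ weilZeroIndex T, (riemannZetaZeroOrder ρ : ℝ) * ‖weilMellin g ρ‖ ^ 2 ≤ B := by
  rw [finsum_weilZeroIndex_normSq_eq_two_mul hreal T]
  rcases lt_or_ge T 0 with hT | hT
  · have hempty : zerosBetween 0 T = ∅ := by
      ext ρ
      simp only [mem_zerosBetween le_rfl, Finset.notMem_empty, iff_false, not_and, not_le]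
      intro _ _ _ h3
      linarith
    rw [hempty, Finset.sum_empty, mul_zero]
    exact hB
  · have := h T hT
    linarith

/-- The members of `zerosBetween 0 T` are zeros of `ζ` in the upper critical strip with `Im ρ ≤ T` — the hypothesis shape of the
cost bricks (`HandoffDodgerFarCost.far_cost_le`, `KadiriTail.upper_sum_le`). [folklore] -/
theorem mem_zerosBetween_zero {T : ℝ} {ρ : ℂ} (h : ρ ∈ zerosBetween 0 T) :
    riemannZeta ρ = 0 ∧ 0 ≤ ρ.re ∧ ρ.re ≤ 1 ∧ 0 < ρ.im ∧ ρ.im ≤ T :=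
  (mem_zerosBetween le_rfl).1 h

end Summit.RiemannHypothesis.RiemannHypothesis.Theorems.Handoff

end
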